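import Literature.Analysis.FunctionSpaces.PVFunctionsProofs
import Literature.Analysis.FunctionSpaces.BussWitnessingPV
import Literature.Computability.Complexity.BoundedArithmeticDefinabilityProofs
import HarnessLib

/-!
# Buss's Main Theorem in `PV` form: discharge of `isPVDefinable_iff_isSigmabDefinable`

Sibling proof file of `PVFunctions.lean` (D-0014) for the named fact
`Literature.Analysis.FunctionSpaces.isPVDefinable_iff_isSigmabDefinable`:

> a unary function `F : ℕ → ℕ` is `PV`-definable (the interpretation of a function symbol of
> Cook's `PV`, i.e. lies in Cobham's class `𝓛`) **iff** it is `Σᵇ₁`-definable in `S₂¹`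

(Buss 1986, Ch. 5, Main Theorem 5 together with Ch. 6, where `S₂¹(PV)` is shown conservative over
`S₂¹` and every `PV` symbol `Σᵇ₁`-definable; Krajíček 1995, Thm. 5.3.1 (Cobham), Lemma 6.1.1 /
§5.2–5.4 (every polynomial-time function is `Σᵇ₁`-definable in `S₂¹`) and Thm. 7.2.3 (Buss's
witnessing theorem)).

The three ingredients are proved elsewhere in the tree and are only assembled here:

* `→` : a `PV`-definable function is polynomial-time computable on binary notation
  (`polyTimeComputable_of_isPVDefinable`, the easy half of Cobham's theorem `cobham_holds`,
  `PVFunctionsProofs.lean`), hence `Σᵇ₁`-definable in `S₂¹`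
  (`Literature.Computability.Complexity.isSigmabDefinable_S2_one_of_polyTimeComputable_holds`,
  `BoundedArithmeticDefinabilityProofs.lean`: the graph of the padded `TM2` computation is a
  `Σᵇ₁` definition, total and functional in every model of `BASIC + Σᵇ₁-PIND`);
* `←` : Buss's witnessing theorem in `PV` form
  (`isPVDefinable_of_isSigmabDefinable_S2_one`, `BussWitnessingPV.lean`, proved
  model-theoretically via Herbrand-saturated models of the true universal theory of `(ℕ, PV)`,
  after Zambella 1996 and Avigad 2002).

## References

* S. R. Buss, *Bounded Arithmetic*, Bibliopolis 1986, Ch. 5 (Main Theorem 5), Ch. 6 (`PV`,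
  `S₂¹(PV)`).
* J. Krajíček, *Bounded Arithmetic, Propositional Logic and Complexity Theory*, CUP 1995,
  Thm. 5.3.1, Lemma 6.1.1, Thm. 7.2.3, Thm. 7.6.3.
* A. Cobham, *The intrinsic computational difficulty of functions*, 1965.
-/

namespace Literature.Analysis.FunctionSpaces

open _root_.Computability Literature.Computability.MetaComplexity Literature.Computability.Complexity

/-- **`PV`-definable ⇒ `Σᵇ₁`-definable in `S₂¹`** (Buss 1986, Ch. 6: every function symbol of `PV`
is `Σᵇ₁`-definable in `S₂¹`; here via Cobham's theorem and the `Σᵇ₁`-definability of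
polynomial-time functions, Krajíček 1995, Thm. 5.3.1 and Lemma 6.1.1).
[cite: Buss1986, Ch. 5, Main Theorem 5 and Ch. 6] -/
theorem isSigmabDefinable_S2_one_of_isPVDefinable {F : ℕ → ℕ}
    (hF : IsPVDefinable fun v : Fin 1 → ℕ => F (v 0)) : IsSigmabDefinable (S2 1) 1 F :=
  isSigmabDefinable_S2_one_of_polyTimeComputable_holds (polyTimeComputable_of_isPVDefinable hF)

/-- **Discharge of `isPVDefinable_iff_isSigmabDefinable` — Buss's Main Theorem in `PV` form**:
a unary function is the interpretation of a `PV` symbol iff it is `Σᵇ₁`-definable in `S₂¹`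
(Buss 1986, Ch. 5, Main Theorem 5, with Ch. 6; Krajíček 1995, Thm. 5.3.1, Lemma 6.1.1,
Thm. 7.2.3).  `→` is `isSigmabDefinable_S2_one_of_isPVDefinable`; `←` is the witnessing theorem
`isPVDefinable_of_isSigmabDefinable_S2_one`. [cite: Buss1986, Ch. 5, Main Theorem 5 and Ch. 6] -/
theorem isPVDefinable_iff_isSigmabDefinable_holds : isPVDefinable_iff_isSigmabDefinable :=
  fun _ => ⟨isSigmabDefinable_S2_one_of_isPVDefinable, isPVDefinable_of_isSigmabDefinable_S2_one⟩

end Literature.Analysis.FunctionSpaces
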